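import Literature.MathematicalPhysics.QuantumFieldTheory.Balaban1983to89.B8Ineq159FlatCubeMemberResidual
import Literature.MathematicalPhysics.QuantumFieldTheory.Balaban1983to89.B8Ineq159StencilsNearFlat

/-!
# `Balaban1983to89.B8Ineq159CurvedCubeMemberPerCube` — [Balaban1985RegularSpaces] (1.59) p. 86 AT A CURVED BACKGROUND ON THE CUBE MEMBER `{□_j}` OF
# (1.131), PER MEMBER, TRUNCATION `m = 1`: for every unit-bounded background `U₀` with `‖U₀(b) − 1‖ ≤ δ₀(□)` and every `𝔸`-valued bond function in the
# CURVED Landau gauge (1.38) of `U₀`, the curved data — current `J_{U₀}`, averages `Q_j(U₀)` over print's class, outer layer — dominate `|φ|`,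
# `|D^η_{U₀}φ|`, `|Δ^η_{U₀}φ|` on the sides of `□_j` with a member-dependent constant: the first (1.59)-type bound of the tree at a NON-FLAT background

statement-level skeleton of published theorems with citation tags; proofs where landed; nothing here is a claim about the
Yang–Mills mass gap

`[Balaban1985RegularSpaces]` ("B8", CMP **99** (1985) 75–102) (1.59) p. 86, (1.62) p. 87, (1.31) p. 82, (1.38) p. 82, (1.68) p. 88, (1.131) p. 99;
`[Balaban1985BackgroundPropagators]` ("[4]", CMP **99** (1985) 389–434) Thm 3.3 p. 399, (3.19) p. 393, (3.23)–(3.25) p. 394, (3.79) p. 406;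
`[Balaban1984PropagatorsII]` ("B6", CMP **96** (1984) 223–250) (2.11) p. 225; `[Balaban1985Averaging]` ("B7") (122)–(126) p. 36.
PDF held: `paper:balaban1985-cmp99-regular-spaces-gauge-fixing` (journal page = PDF page + 74).

CITATION HEADER (lean-in-tree rule).  Cell `pub-ymgap` (YM Track A, HUMAN RULING D-0062 ∕ D-0149), DAG node N05 = [B8], width seat
`pub-ymgap-dag-n05-w3` (g2), CLAIM-1 file (D), FIRST EDITION (truncation `m = 1`).  WHY.  Every (1.59) clause in the tree is either a displayed socket
([4] Thm 3.3 for `G(U₀)`, `SockB9P3` ∕ `SockH59`) or PROVED at the FLAT background `U₀ = 1` (dag-n05-c's transplant, g0's kernel certificate, file (A)).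
The W-SEAT START LIST §n05 item 4 asks for the A6 content at `m ≥ 1` beyond the flat model.  THIS FILE gives the per-member, small-background
version: the flat kernel certificate SURVIVES a small curvature of the background.  Mechanism: the residual-tolerant flat estimate with multiplier
control (file (B), `exists_bound_flat_residual_perCube`) applied to `(φ, μ)` where `μ` is the multiplier of the CURVED Landau condition; the flat data of
`φ` differ from the curved data by `O(δ)·(sup|φ| + sup|μ|)` (file (C): current, Landau stencil, level-one transpose and average); the flat conclusion
bounds `sup|φ| + sup|μ|` by the flat data; for `δ ≤ δ₀(□)` the loop closes (a linear bootstrap), and the curved derivatives are recovered from the flat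
ones by file (C) again.

THE MATHEMATICS (kernel-checked; `𝔸` a finite-dimensional complete normed `ℂ`-algebra; `d ≥ 2`, `L ≥ 1`, `η > 0`, cube datum `(a, M, ρ, k)`, `k ≥ 1`,
truncation `m = 1`).  ★★★ `exists_curved159_perCube_truncOne`: THERE ARE `δ₀ > 0` and `B′ > 0` (depending on the member and `𝔸`) such that for every
background `U₀` with `U₀(b) ∈ U1` and `‖U₀(b) − 1‖ ≤ δ₀` on all bonds, every `𝔸`-valued `φ` in the curved Landau gauge `IsLandau138 L 1 η □₀ (cubeLamS … 1) U₀ φ`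
vanishing on the bonds that side-touch neither `□₀` nor `□₁`, and every `N ≥ 0` bounding (i) `(Lʲη)³|J_{U₀}(φ)|` on the bonds of `□_j` (`j ≤ 1`), (ii) the CURVED
averages `|Lʲη·Q_j(U₀)(iηφ)(c)|` on print's class `cubeLamBP … 1 j`, (iii) `η|φ|` on the outer layer: on every bond side-touching `□_j` (`j ≤ 1`)
`(Lʲη)|φ| ≤ B′N`, `(Lʲη)²|D^η_{U₀,ν}φ_τ| ≤ B′N`, `(Lʲη)³|Δ^η_{U₀}φ_τ| ≤ B′N`.  Also `QT_congr_on` (the transpose at any background reads the multiplier on the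
restriction sets only).

HONEST SCOPE ∕ A6.  (i) PER MEMBER: `δ₀(□), B′(□)` depend on the member (and on `𝔸`) through file (B)'s non-explicit constant — NOT print's uniform `B₀(d, L)`,
NOT [4] Thm 3.3 (whose content is uniformity in the member AND validity for all of `𝔄_k(α₀)` with `α₀ = O(1)`), nothing of the random-walk expansion.
(ii) TRUNCATION `m = 1` ONLY (the level-one transpose and average are one-step; the averaging tower `Ū₀ʲ`, `j ≥ 2`, needs [B7] Prop. 2's averaging-closed
regime — a later edition).  (iii) Closeness `‖U₀(b) − 1‖ ≤ δ₀` is asked on ALL bonds of `ℤᵈ` and in the given gauge — NOT the gauge-invariant class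
`InAk(α₀)` of the sockets; so this is NOT an inhabitant of `SockB9P3` ∕ `SockH59` as typed (that needs the gauge covariance of the package + an axial gauge,
not here).  (iv) What it IS: the first kernel-checked (1.59)-type bound at a non-flat background; an A6 witness that the curved (1.59) data over print's
class at `m = 1` have no zero mode near `U₀ = 1` at any cube member.  Count-neutral; N05 NOT discharged; no count claim; one finite `𝕋⁴` programme at fixed
`ε`, Bałaban as printed; the YM mass gap (Clay) is NOT proved by any of this — R4 closes the conditional finite-`𝕋⁴` rung `BalabanLadder.UV` only; nothing
continuum ∕ ℝ⁴ ∕ OS.  No `sorry`, no `def`, no `instance`, no `notation`; `set_option maxHeartbeats 400000` for the one assembly proof (twice the default).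
Unit `pub-ymgap-dag-n05-w3` (g2), 2026-08-28.
-/

noncomputable section

namespace Literature.MathematicalPhysics.QuantumFieldTheory.Balaban1983to89.B8Ineq159CurvedCubeMemberPerCube

open B7Prop1Explicit B7Prop2Explicit B7Prop1Local
open B7Prop4GeneralLevels (linCovIter)
open B8Ineq132 (covDerivFwd covDeriv BondTouches)
open B8Eq140Level (SideTouches)
open B8Eq146AExpansion (iEta)
open B8Eq155JBound (Jcur)
open B8Eq138LandauZd (IsLandau138 covLap covDivB QT QprimeT)
open B8Eq131CubesAdmissible (cubeFam)
open B8CubeMemberZd (cubeLamS)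
open B8Ineq159FlatCubeMemberPrinted (cubeLamBP)
open B8Ineq159FlatCubeMemberPerCube (sideTouches_pairs_finite)
open B8Ineq159FlatCubeMemberResidual (exists_bound_flat_residual_perCube cubeLamS_pairs_finite)
open B8Ineq159StencilsNearFlat (norm_covDerivFwd_sub_flat_le norm_Jcur_sub_flat_le norm_covLap_sub_flat_le norm_landauStencil_sub_flat_le
  norm_QT_one_sub_flat_le norm_linCovIter_le_one_sub_flat_le)

export B7Prop1Explicit (Site)

variable {d : ℕ} {𝔸 : Type*} [NormedRing 𝔸] [NormOneClass 𝔸] [NormedAlgebra ℂ 𝔸] [CompleteSpace 𝔸]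

omit [NormOneClass 𝔸] in
/-- **`Q′(U₀)ᵀ` reads the multiplier on the restriction sets only** (any background): if `μ`, `μ′` agree on `Λs j`, `j ≤ m`, then `Q′(U₀)ᵀμ = Q′(U₀)ᵀμ′`.
[cite: Balaban1985BackgroundPropagators, (3.24) p.394] -/
theorem QT_congr_on (L m : ℕ) (Λs : ℕ → Set (Site d)) (U₀ : Site d → Fin d → 𝔸ˣ) {μ μ' : ℕ → Site d → 𝔸}
    (h : ∀ j, j ≤ m → ∀ y ∈ Λs j, μ j y = μ' j y) (x : Site d) : QT L m Λs U₀ μ x = QT L m Λs U₀ μ' x := by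
  unfold QT
  refine Finset.sum_congr rfl fun j hj => ?_
  have hind : (Λs j).indicator (μ j) = (Λs j).indicator (μ' j) := by
    funext y
    by_cases hy : y ∈ Λs j
    · rw [Set.indicator_of_mem hy, Set.indicator_of_mem hy, h j (Nat.lt_succ_iff.mp (Finset.mem_range.mp hj)) y hy]
    · rw [Set.indicator_of_notMem hy, Set.indicator_of_notMem hy]
  rw [hind]

set_option maxHeartbeats 400000 in
-- one long assembly proof (the bootstrap carries ~40 named estimates); twice the default budget, no `decide` ∕ heavy automation
/-- ★★★ **(1.59) AT A CURVED BACKGROUND ON THE CUBE MEMBER, PER MEMBER, TRUNCATION `m = 1`.**  For `d ≥ 2`, `L ≥ 1`, `η > 0`, a cube datum `(a, M, ρ, k)` of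
(1.131) with `k ≥ 1`, and `𝔸` a finite-dimensional complete normed `ℂ`-algebra, THERE ARE `δ₀ > 0` and `B′ > 0` (depending on the member and `𝔸`) such that:
for every background `U₀` with unit-bounded bond variables `δ₀`-close to `1` on all of `ℤᵈ`, every `𝔸`-valued bond function `φ` in the CURVED Landau gauge
of record `IsLandau138 L 1 η □₀ (cubeLamS … 1) U₀ φ` ((1.38), multiplier form, truncation `1`) vanishing on the bonds side-touching neither `□₀` nor `□₁`, and
every `N ≥ 0` bounding (i) `(Lʲη)³|J_{U₀}(φ)|` on the bonds of `□_j`, `j ≤ 1`, (ii) the curved un-normalised averages `|Lʲη·Q_j(U₀)(iηφ)(c)|` on print's class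
`cubeLamBP … 1 j`, (iii) `η|φ|` on the outer layer — on every bond side-touching `□_j` (`j ≤ 1`): `(Lʲη)|φ| ≤ B′N`, `(Lʲη)²|D^η_{U₀,ν}φ_τ| ≤ B′N`,
`(Lʲη)³|Δ^η_{U₀}φ_τ| ≤ B′N`.  PROOF: file (B) at `(φ, μ)`, `μ` the curved multiplier; file (C) prices flat-vs-curved data by `δ·(Σ|φ| + Σ|μ|)`; file (B)'s
conclusion bounds `Σ|φ| + Σ|μ|` by the flat data; for `δ ≤ δ₀` the linear bootstrap closes; file (C) converts the flat derivatives back.  HONEST SCOPE: per member,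
non-explicit constants; `m = 1`; closeness in the given gauge, not `InAk` — not a socket inhabitant; not [4] Thm 3.3.
[cite: Balaban1985RegularSpaces, (1.59) p.86, (1.62) p.87, (1.31) p.82, (1.38) p.82, (1.131) p.99; Balaban1985BackgroundPropagators, Thm 3.3 p.399, (3.24)–(3.25) p.394, (3.79) p.406; Balaban1984PropagatorsII, (2.11) p.225] -/
theorem exists_curved159_perCube_truncOne [FiniteDimensional ℂ 𝔸] (hd2 : 2 ≤ d) {L : ℕ} (hL : 1 ≤ L) {η : ℝ} (hη : 0 < η)
    (a : Site d) (M ρ : ℕ) {k : ℕ} (hk : 1 ≤ k) :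
    ∃ δ₀ B' : ℝ, 0 < δ₀ ∧ 0 < B' ∧ ∀ (U₀ : Site d → Fin d → 𝔸ˣ), (∀ x κ, U₀ x κ ∈ U1 𝔸) →
      (∀ x κ, ‖((U₀ x κ : 𝔸ˣ) : 𝔸) - 1‖ ≤ δ₀) →
      ∀ φ : Site d → Fin d → 𝔸,
        IsLandau138 L 1 η (cubeFam false L a M ρ k 0) (cubeLamS L a M ρ k 1) U₀ φ →
        (∀ (y : Site d) (τ : Fin d), (∀ j, j ≤ 1 → ¬ SideTouches (cubeFam false L a M ρ k j) y τ) → φ y τ = 0) →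
        ∀ N : ℝ, 0 ≤ N →
          (∀ j, j ≤ 1 → ∀ (y : Site d) (τ : Fin d), BondTouches (cubeFam false L a M ρ k j) y τ →
              ((L : ℝ) ^ j * η) ^ 3 * ‖Jcur η U₀ φ τ y‖ ≤ N) →
          (∀ j, j ≤ 1 → ∀ c ∈ cubeLamBP L a M ρ k 1 j, ‖linCovIter L U₀ (iEta η φ) j c.1 c.2‖ ≤ N) →
          (∀ (y : Site d) (τ : Fin d), ¬ BondTouches (cubeFam false L a M ρ k 0) y τ → η * ‖φ y τ‖ ≤ N) →
          ∀ j, j ≤ 1 → ∀ (y : Site d) (τ : Fin d), SideTouches (cubeFam false L a M ρ k j) y τ →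
            ((L : ℝ) ^ j * η) * ‖φ y τ‖ ≤ B' * N ∧
            (∀ ν : Fin d, ((L : ℝ) ^ j * η) ^ 2 * ‖covDerivFwd η U₀ ν (fun z => φ z τ) y‖ ≤ B' * N) ∧
            ((L : ℝ) ^ j * η) ^ 3 * ‖covLap η U₀ (fun z => φ z τ) y‖ ≤ B' * N := by
  classical
  obtain ⟨B, hB, H⟩ := exists_bound_flat_residual_perCube (𝔸 := 𝔸) hd2 hL hη a M ρ (k := k) (m := 1) le_rfl hk
  -- finite index sets: side-touching bonds (targets ∕ support), restriction-set sites (multiplier)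
  set TS := (sideTouches_pairs_finite L a M ρ hk).toFinset with hTS
  set TM := (cubeLamS_pairs_finite L a M ρ k 1).toFinset with hTM
  have memTS : ∀ {j y τ}, j ≤ 1 → SideTouches (cubeFam false L a M ρ k j) y τ → (j, (y, τ)) ∈ TS := fun hj hs => by
    rw [hTS, Set.Finite.mem_toFinset]; exact ⟨hj, hs⟩
  have memTM : ∀ {j y}, j ≤ 1 → y ∈ cubeLamS L a M ρ k 1 j → (j, y) ∈ TM := fun hj hy => by
    rw [hTM, Set.Finite.mem_toFinset]; exact ⟨hj, hy⟩
  -- constants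
  have hL0 : (0 : ℝ) < L := by exact_mod_cast hL
  have hL1 : (1 : ℝ) ≤ L := by exact_mod_cast hL
  have hd : (0 : ℝ) ≤ d := Nat.cast_nonneg d
  have hη0 : 0 ≤ η := hη.le
  obtain ⟨C₁, hC₁⟩ : ∃ C₁ : ℝ,
      C₁ = 24 * d ^ 2 * (η ^ 3)⁻¹ + ((L : ℝ) * η) ^ 3 * (32 * d * (η ^ 2)⁻¹) + 102 * ((d : ℝ) + 1) ^ 2 * L ^ 2 * η := ⟨_, rfl⟩
  obtain ⟨C₂, hC₂⟩ : ∃ C₂ : ℝ, C₂ = ((L : ℝ) ^ d)⁻¹ * (2 * (d * L)) := ⟨_, rfl⟩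
  obtain ⟨C₀, hC₀⟩ : ∃ C₀ : ℝ, C₀ = C₁ + C₂ := ⟨_, rfl⟩
  have hC₁0 : 0 ≤ C₁ := by rw [hC₁]; positivity
  have hC₂0 : 0 ≤ C₂ := by rw [hC₂]; positivity
  have hC₀0 : 0 ≤ C₀ := by rw [hC₀]; positivity
  obtain ⟨K, hK⟩ : ∃ K : ℝ, K = (TS.card : ℝ) * η⁻¹ * B + (TM.card : ℝ) * B := ⟨_, rfl⟩
  have hK0 : 0 ≤ K := by rw [hK]; positivity
  obtain ⟨δ₀, hδ₀⟩ : ∃ δ₀ : ℝ, δ₀ = min (1 / (128 * ((d : ℝ) + 1) * L)) (1 / (2 * K * C₀ + 2)) := ⟨_, rfl⟩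
  have hδ₀pos : 0 < δ₀ := by rw [hδ₀]; exact lt_min (by positivity) (by positivity)
  have hδ0 : (0 : ℝ) ≤ δ₀ := hδ₀pos.le
  have hδ₀1 : 128 * ((d : ℝ) + 1) * L * δ₀ ≤ 1 := by
    have h : δ₀ ≤ 1 / (128 * ((d : ℝ) + 1) * L) := by rw [hδ₀]; exact min_le_left _ _
    have hpos : 0 < 128 * ((d : ℝ) + 1) * L := by positivity
    calc 128 * ((d : ℝ) + 1) * L * δ₀ ≤ 128 * ((d : ℝ) + 1) * L * (1 / (128 * ((d : ℝ) + 1) * L)) :=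
          mul_le_mul_of_nonneg_left h hpos.le
      _ = 1 := by rw [one_div, mul_inv_cancel₀ hpos.ne']
  have hδ₀2 : K * C₀ * δ₀ ≤ 1 / 2 := by
    have h : δ₀ ≤ 1 / (2 * K * C₀ + 2) := by rw [hδ₀]; exact min_le_right _ _
    have hpos : 0 < 2 * K * C₀ + 2 := by positivity
    have hKC : 0 ≤ K * C₀ := mul_nonneg hK0 hC₀0
    calc K * C₀ * δ₀ ≤ K * C₀ * (1 / (2 * K * C₀ + 2)) := mul_le_mul_of_nonneg_left h hKC
      _ = K * C₀ / (2 * K * C₀ + 2) := by ring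
      _ ≤ 1 / 2 := by rw [div_le_iff₀ hpos]; nlinarith
  have hδ₀le1 : δ₀ ≤ 1 := by
    have h1 : (1 : ℝ) ≤ 128 * ((d : ℝ) + 1) * L := by nlinarith
    have h2 : δ₀ ≤ 128 * ((d : ℝ) + 1) * L * δ₀ := le_mul_of_one_le_left hδ0 h1
    linarith
  obtain ⟨B', hB'⟩ : ∃ B' : ℝ, B' = 2 * B + (4 * (L : ℝ) ^ 2 * η + 16 * d * (L : ℝ) ^ 3 * η) * K + 1 := ⟨_, rfl⟩
  have hB'pos : 0 < B' := by rw [hB']; positivity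
  have hB'ge : 2 * B + (4 * (L : ℝ) ^ 2 * η + 16 * d * (L : ℝ) ^ 3 * η) * K ≤ B' := by rw [hB']; linarith
  have hKterm : 0 ≤ (4 * (L : ℝ) ^ 2 * η + 16 * d * (L : ℝ) ^ 3 * η) * K := by positivity
  refine ⟨δ₀, B', hδ₀pos, hB'pos, ?_⟩
  intro U₀ hU hδ φ hLan hs N hN h1 h2 h3
  -- the curved multiplier, restricted to the restriction sets
  obtain ⟨μ, hμ⟩ := hLan
  obtain ⟨μ', hμ'def⟩ : ∃ μ' : ℕ → Site d → 𝔸, μ' = fun j y => if j ≤ 1 ∧ y ∈ cubeLamS L a M ρ k 1 j then μ j y else 0 :=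
    ⟨_, rfl⟩
  have hμ'app : ∀ (j : ℕ) (y : Site d), μ' j y = if j ≤ 1 ∧ y ∈ cubeLamS L a M ρ k 1 j then μ j y else 0 :=
    fun j y => by rw [hμ'def]
  have hμ'eq : ∀ j, j ≤ 1 → ∀ y ∈ cubeLamS L a M ρ k 1 j, μ j y = μ' j y := fun j hj y hy => by
    rw [hμ'app, if_pos ⟨hj, hy⟩]
  have hres : ∀ x ∈ cubeFam false L a M ρ k 0,
      covLap η U₀ ((cubeFam false L a M ρ k 0).indicator (covDivB η U₀ φ)) x = QT L 1 (cubeLamS L a M ρ k 1) U₀ μ' x := by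
    intro x hx
    rw [hμ x hx, QT_congr_on L 1 _ U₀ hμ'eq x]
  -- the two sup-substitutes: `Tφ` (sum of `‖φ‖` over the side-touching bonds) and `Tμ` (sum of `‖μ′‖` over the restriction sets)
  obtain ⟨Tφ, hTφ⟩ : ∃ Tφ : ℝ, Tφ = ∑ q ∈ TS, ‖φ q.2.1 q.2.2‖ := ⟨_, rfl⟩
  obtain ⟨Tμ, hTμ⟩ : ∃ Tμ : ℝ, Tμ = ∑ p ∈ TM, ‖μ' p.1 p.2‖ := ⟨_, rfl⟩
  have hTφ0 : 0 ≤ Tφ := by rw [hTφ]; exact Finset.sum_nonneg fun _ _ => norm_nonneg _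
  have hTμ0 : 0 ≤ Tμ := by rw [hTμ]; exact Finset.sum_nonneg fun _ _ => norm_nonneg _
  have hφle : ∀ (y : Site d) (τ : Fin d), ‖φ y τ‖ ≤ Tφ := by
    intro y τ
    by_cases h : ∃ j, j ≤ 1 ∧ SideTouches (cubeFam false L a M ρ k j) y τ
    · obtain ⟨j, hj, hst⟩ := h
      rw [hTφ]
      exact Finset.single_le_sum (f := fun q : ℕ × (Site d × Fin d) => ‖φ q.2.1 q.2.2‖) (fun _ _ => norm_nonneg _) (memTS hj hst)
    · push Not at h
      rw [hs y τ fun j hj hst => h j hj hst, norm_zero]; exact hTφ0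
  have hμ'le : ∀ (j : ℕ) (y : Site d), ‖μ' j y‖ ≤ Tμ := by
    intro j y
    by_cases h : j ≤ 1 ∧ y ∈ cubeLamS L a M ρ k 1 j
    · rw [hTμ]
      exact Finset.single_le_sum (f := fun p : ℕ × Site d => ‖μ' p.1 p.2‖) (fun _ _ => norm_nonneg _) (memTM h.1 h.2)
    · have : μ' j y = 0 := by
        rw [hμ'app, if_neg h]
      rw [this, norm_zero]; exact hTμ0
  have hiEta : ∀ (y : Site d) (κ : Fin d), ‖iEta η φ y κ‖ ≤ η * Tφ := fun y κ => B8Eq146AExpansion.norm_iEta_le hη.le hφle y κ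
  -- weights at `j ≤ 1`
  have hwj : ∀ j, j ≤ 1 → (L : ℝ) ^ j * η ≤ L * η := fun j hj => by
    refine mul_le_mul_of_nonneg_right ?_ hη0
    calc (L : ℝ) ^ j ≤ (L : ℝ) ^ 1 := pow_le_pow_right₀ hL1 hj
      _ = L := pow_one _
  have hwj0 : ∀ j : ℕ, 0 ≤ (L : ℝ) ^ j * η := fun j => by positivity
  -- the flat data of `(φ, μ′)` with the bound `N′ = N + C₀δ₀(Tφ + Tμ)`
  obtain ⟨X, hX⟩ : ∃ X : ℝ, X = Tφ + Tμ := ⟨_, rfl⟩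
  have hX0 : 0 ≤ X := by rw [hX]; positivity
  have hTφX : Tφ ≤ X := by rw [hX]; linarith
  have hTμX : Tμ ≤ X := by rw [hX]; linarith
  obtain ⟨N', hN'⟩ : ∃ N' : ℝ, N' = N + C₀ * δ₀ * X := ⟨_, rfl⟩
  have hN'0 : 0 ≤ N' := by rw [hN']; positivity
  have hC₁le : C₁ ≤ C₀ := by rw [hC₀]; linarith
  have hC₂le : C₂ ≤ C₀ := by rw [hC₀]; linarith
  have hC₁X : C₁ * δ₀ * Tφ ≤ C₀ * δ₀ * X := by gcongr
  have hsum : C₁ * δ₀ * Tφ + C₂ * δ₀ * Tμ ≤ C₀ * δ₀ * X := by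
    have a1 : C₁ * δ₀ * Tφ ≤ C₁ * δ₀ * X := by gcongr
    have a2 : C₂ * δ₀ * Tμ ≤ C₂ * δ₀ * X := by gcongr
    have e : C₁ * δ₀ * X + C₂ * δ₀ * X = C₀ * δ₀ * X := by rw [hC₀]; ring
    linarith
  -- (o) the flat Landau residual
  have h0' : ∀ x ∈ cubeFam false L a M ρ k 0,
      ‖covLap η (1 : Site d → Fin d → 𝔸ˣ) ((cubeFam false L a M ρ k 0).indicator (covDivB η (1 : Site d → Fin d → 𝔸ˣ) φ)) x
        - QT L 1 (cubeLamS L a M ρ k 1) (1 : Site d → Fin d → 𝔸ˣ) μ' x‖ ≤ N' := by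
    intro x hx
    have e : covLap η (1 : Site d → Fin d → 𝔸ˣ) ((cubeFam false L a M ρ k 0).indicator (covDivB η (1 : Site d → Fin d → 𝔸ˣ) φ)) x
        - QT L 1 (cubeLamS L a M ρ k 1) (1 : Site d → Fin d → 𝔸ˣ) μ' x =
        -(covLap η U₀ ((cubeFam false L a M ρ k 0).indicator (covDivB η U₀ φ)) x
            - covLap η (1 : Site d → Fin d → 𝔸ˣ) ((cubeFam false L a M ρ k 0).indicator (covDivB η (1 : Site d → Fin d → 𝔸ˣ) φ)) x)
          + (QT L 1 (cubeLamS L a M ρ k 1) U₀ μ' x - QT L 1 (cubeLamS L a M ρ k 1) (1 : Site d → Fin d → 𝔸ˣ) μ' x) := by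
      rw [← hres x hx]; abel
    rw [e]
    have hA := norm_landauStencil_sub_flat_le hU hδ hη hδ0 (cubeFam false L a M ρ k 0) hTφ0 hφle x
    have hQ := norm_QT_one_sub_flat_le hU hδ hL hδ0 (cubeLamS L a M ρ k 1) μ' hTμ0 (fun y _ => hμ'le 1 y) x
    refine (norm_add_le _ _).trans ?_
    rw [norm_neg]
    refine (add_le_add hA hQ).trans ?_
    have hc1 : 24 * (d : ℝ) ^ 2 * (η ^ 3)⁻¹ ≤ C₁ := by
      rw [hC₁]
      have t1 : 0 ≤ ((L : ℝ) * η) ^ 3 * (32 * d * (η ^ 2)⁻¹) := by positivity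
      have t2 : 0 ≤ 102 * ((d : ℝ) + 1) ^ 2 * L ^ 2 * η := by positivity
      linarith
    have e1 : 24 * (d : ℝ) ^ 2 * (η ^ 3)⁻¹ * δ₀ * Tφ ≤ C₁ * δ₀ * Tφ := by gcongr
    have e2 : ((L : ℝ) ^ d)⁻¹ * (2 * (d * L * δ₀) * Tμ) = C₂ * δ₀ * Tμ := by rw [hC₂]; ring
    rw [e2, hN']
    linarith [e1, hsum]
  -- (i) the flat current
  have hpow3 : ∀ j, j ≤ 1 → ((L : ℝ) ^ j * η) ^ 3 ≤ ((L : ℝ) * η) ^ 3 := fun j hj => pow_le_pow_left₀ (hwj0 j) (hwj j hj) 3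
  have hpow2 : ∀ j, j ≤ 1 → ((L : ℝ) ^ j * η) ^ 2 ≤ ((L : ℝ) * η) ^ 2 := fun j hj => pow_le_pow_left₀ (hwj0 j) (hwj j hj) 2
  have hJC₁ : ((L : ℝ) * η) ^ 3 * (32 * d * (η ^ 2)⁻¹) ≤ C₁ := by
    rw [hC₁]
    have t1 : 0 ≤ 24 * (d : ℝ) ^ 2 * (η ^ 3)⁻¹ := by positivity
    have t2 : 0 ≤ 102 * ((d : ℝ) + 1) ^ 2 * L ^ 2 * η := by positivity
    linarith
  have hQC₁ : 102 * ((d : ℝ) + 1) ^ 2 * L ^ 2 * η ≤ C₁ := by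
    rw [hC₁]
    have t1 : 0 ≤ 24 * (d : ℝ) ^ 2 * (η ^ 3)⁻¹ := by positivity
    have t2 : 0 ≤ ((L : ℝ) * η) ^ 3 * (32 * d * (η ^ 2)⁻¹) := by positivity
    linarith
  have h1' : ∀ j, j ≤ 1 → ∀ (y : Site d) (τ : Fin d), BondTouches (cubeFam false L a M ρ k j) y τ →
      ((L : ℝ) ^ j * η) ^ 3 * ‖Jcur η (1 : Site d → Fin d → 𝔸ˣ) φ τ y‖ ≤ N' := by
    intro j hj y τ hbt
    have hJ := norm_Jcur_sub_flat_le hU hδ hη hTφ0 hφle τ y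
    have hflat : ‖Jcur η (1 : Site d → Fin d → 𝔸ˣ) φ τ y‖ ≤ ‖Jcur η U₀ φ τ y‖ + 32 * d * (η ^ 2)⁻¹ * δ₀ * Tφ :=
      (norm_le_insert _ _).trans (add_le_add le_rfl hJ)
    have hw3 : 0 ≤ ((L : ℝ) ^ j * η) ^ 3 := pow_nonneg (hwj0 j) 3
    calc ((L : ℝ) ^ j * η) ^ 3 * ‖Jcur η (1 : Site d → Fin d → 𝔸ˣ) φ τ y‖
        ≤ ((L : ℝ) ^ j * η) ^ 3 * ‖Jcur η U₀ φ τ y‖ + ((L : ℝ) ^ j * η) ^ 3 * (32 * d * (η ^ 2)⁻¹ * δ₀ * Tφ) := by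
          rw [← mul_add]; exact mul_le_mul_of_nonneg_left hflat hw3
      _ ≤ N + ((L : ℝ) * η) ^ 3 * (32 * d * (η ^ 2)⁻¹ * δ₀ * Tφ) :=
          add_le_add (h1 j hj y τ hbt) (mul_le_mul_of_nonneg_right (hpow3 j hj) (by positivity))
      _ = N + (((L : ℝ) * η) ^ 3 * (32 * d * (η ^ 2)⁻¹)) * δ₀ * Tφ := by ring
      _ ≤ N + C₁ * δ₀ * Tφ := by gcongr
      _ ≤ N' := by rw [hN']; linarith [hC₁X]
  -- (ii) the flat averages over print's class
  have h2' : ∀ j, j ≤ 1 → ∀ c ∈ cubeLamBP L a M ρ k 1 j,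
      ‖linCovIter L (1 : Site d → Fin d → 𝔸ˣ) (iEta η φ) j c.1 c.2‖ ≤ N' := by
    intro j hj c hc
    have hQ := norm_linCovIter_le_one_sub_flat_le hU hδ hL hδ0 hδ₀1 (by positivity) hiEta j hj c.1 c.2
    have hflat : ‖linCovIter L (1 : Site d → Fin d → 𝔸ˣ) (iEta η φ) j c.1 c.2‖ ≤
        ‖linCovIter L U₀ (iEta η φ) j c.1 c.2‖ + 102 * ((d : ℝ) + 1) ^ 2 * L ^ 2 * δ₀ * (η * Tφ) :=
      (norm_le_insert _ _).trans (add_le_add le_rfl hQ)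
    calc ‖linCovIter L (1 : Site d → Fin d → 𝔸ˣ) (iEta η φ) j c.1 c.2‖
        ≤ N + 102 * ((d : ℝ) + 1) ^ 2 * L ^ 2 * δ₀ * (η * Tφ) := hflat.trans (add_le_add (h2 j hj c hc) le_rfl)
      _ = N + (102 * ((d : ℝ) + 1) ^ 2 * L ^ 2 * η) * δ₀ * Tφ := by ring
      _ ≤ N + C₁ * δ₀ * Tφ := by gcongr
      _ ≤ N' := by rw [hN']; linarith [hC₁X]
  -- (iii) the outer layer
  have hNN' : N ≤ N' := by
    rw [hN']
    have : 0 ≤ C₀ * δ₀ * X := by positivity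
    linarith
  have h3' : ∀ (y : Site d) (τ : Fin d), ¬ BondTouches (cubeFam false L a M ρ k 0) y τ → η * ‖φ y τ‖ ≤ N' :=
    fun y τ h => (h3 y τ h).trans hNN'
  -- the flat estimate with residual
  obtain ⟨keyφ, keyμ⟩ := H φ μ' hs N' hN'0 h0' h1' h2' h3'
  clear H h0' h1' h2' h3' hres hμ
  -- bootstrap: `X ≤ K·N′`
  have hTφle : Tφ ≤ (TS.card : ℝ) * η⁻¹ * B * N' := by
    have hq : ∀ q ∈ TS, ‖φ q.2.1 q.2.2‖ ≤ η⁻¹ * B * N' := by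
      intro q hq
      have hq' : q.1 ≤ 1 ∧ SideTouches (cubeFam false L a M ρ k q.1) q.2.1 q.2.2 := by
        rw [hTS, Set.Finite.mem_toFinset] at hq; exact hq
      have hb := (keyφ q.1 hq'.1 q.2.1 q.2.2 hq'.2).1
      have hwge : η ≤ (L : ℝ) ^ q.1 * η := le_mul_of_one_le_left hη0 (one_le_pow₀ hL1)
      have hη' : η * ‖φ q.2.1 q.2.2‖ ≤ B * N' := (mul_le_mul_of_nonneg_right hwge (norm_nonneg _)).trans hb
      have hηne : η ≠ 0 := hη.ne'
      have e1 : ‖φ q.2.1 q.2.2‖ = η⁻¹ * (η * ‖φ q.2.1 q.2.2‖) := by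
        rw [← mul_assoc, inv_mul_cancel₀ hηne, one_mul]
      rw [e1, mul_assoc η⁻¹ B N']
      exact mul_le_mul_of_nonneg_left hη' (inv_nonneg.2 hη0)
    calc Tφ = ∑ q ∈ TS, ‖φ q.2.1 q.2.2‖ := hTφ
      _ ≤ ∑ _q ∈ TS, η⁻¹ * B * N' := Finset.sum_le_sum hq
      _ = (TS.card : ℝ) * η⁻¹ * B * N' := by rw [Finset.sum_const, nsmul_eq_mul]; ring
  have hTμle : Tμ ≤ (TM.card : ℝ) * B * N' := by
    have hp : ∀ p ∈ TM, ‖μ' p.1 p.2‖ ≤ B * N' := by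
      intro p hp
      have hp' : p.1 ≤ 1 ∧ p.2 ∈ cubeLamS L a M ρ k 1 p.1 := by
        rw [hTM, Set.Finite.mem_toFinset] at hp; exact hp
      exact keyμ p.1 hp'.1 p.2 hp'.2
    calc Tμ = ∑ p ∈ TM, ‖μ' p.1 p.2‖ := hTμ
      _ ≤ ∑ _p ∈ TM, B * N' := Finset.sum_le_sum hp
      _ = (TM.card : ℝ) * B * N' := by rw [Finset.sum_const, nsmul_eq_mul]; ring
  have hXle : X ≤ K * N' := by
    rw [hX, hK]
    calc Tφ + Tμ ≤ (TS.card : ℝ) * η⁻¹ * B * N' + (TM.card : ℝ) * B * N' := add_le_add hTφle hTμle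
      _ = ((TS.card : ℝ) * η⁻¹ * B + (TM.card : ℝ) * B) * N' := by ring
  have hX2 : X ≤ 2 * K * N := by
    have h := hXle
    rw [hN'] at h
    have h' : K * (N + C₀ * δ₀ * X) = K * N + (K * C₀ * δ₀) * X := by ring
    rw [h'] at h
    have h'' : (K * C₀ * δ₀) * X ≤ (1 / 2) * X := mul_le_mul_of_nonneg_right hδ₀2 hX0
    linarith
  have hN'le : N' ≤ 2 * N := by
    rw [hN']
    have h1 : C₀ * δ₀ * X ≤ C₀ * δ₀ * (2 * K * N) := by gcongr
    have h2 : C₀ * δ₀ * (2 * K * N) = 2 * (K * C₀ * δ₀) * N := by ring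
    have h3 : 2 * (K * C₀ * δ₀) * N ≤ 2 * (1 / 2) * N := by gcongr
    linarith
  -- the targets at the curved background
  have hKN : 0 ≤ K * N := by positivity
  intro j hj y τ hst
  obtain ⟨t1, t2, t3⟩ := keyφ j hj y τ hst
  have hw0 : 0 ≤ (L : ℝ) ^ j * η := hwj0 j
  have hBN' : B * N' ≤ 2 * B * N := by
    calc B * N' ≤ B * (2 * N) := by gcongr
      _ = 2 * B * N := by ring
  refine ⟨?_, fun ν => ?_, ?_⟩
  · -- `(Lʲη)|φ| ≤ B N′ ≤ 2B N ≤ B′N`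
    calc (L : ℝ) ^ j * η * ‖φ y τ‖ ≤ B * N' := t1
      _ ≤ 2 * B * N := hBN'
      _ ≤ B' * N := mul_le_mul_of_nonneg_right (by linarith) hN
  · -- `(Lʲη)²|D^η_{U₀}φ| ≤ B N′ + (Lη)²·η⁻¹·2δ₀·Tφ`
    have hD := norm_covDerivFwd_sub_flat_le hU hδ hη ν (fun z => φ z τ) y
    have hflat := t2 ν
    have hcurv : ‖covDerivFwd η U₀ ν (fun z => φ z τ) y‖ ≤
        ‖covDerivFwd η (1 : Site d → Fin d → 𝔸ˣ) ν (fun z => φ z τ) y‖ + η⁻¹ * (2 * δ₀ * Tφ) :=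
      (norm_le_insert' _ _).trans (add_le_add le_rfl (hD.trans (by gcongr; exact hφle _ _)))
    have hw2 : 0 ≤ ((L : ℝ) ^ j * η) ^ 2 := pow_nonneg hw0 2
    have e : ((L : ℝ) * η) ^ 2 * (η⁻¹ * (2 * δ₀ * Tφ)) = 2 * (L : ℝ) ^ 2 * η * δ₀ * Tφ := by
      have hηne : η ≠ 0 := hη.ne'
      have hc : η ^ 2 * η⁻¹ = η := by rw [pow_two, mul_assoc, mul_inv_cancel₀ hηne, mul_one]
      calc ((L : ℝ) * η) ^ 2 * (η⁻¹ * (2 * δ₀ * Tφ)) = (L : ℝ) ^ 2 * (η ^ 2 * η⁻¹) * (2 * δ₀ * Tφ) := by ring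
        _ = 2 * (L : ℝ) ^ 2 * η * δ₀ * Tφ := by rw [hc]; ring
    have hrest : 2 * (L : ℝ) ^ 2 * η * δ₀ * Tφ ≤ (4 * (L : ℝ) ^ 2 * η) * (K * N) := by
      have hδT : δ₀ * Tφ ≤ 2 * K * N := by
        calc δ₀ * Tφ ≤ 1 * (2 * K * N) := by gcongr; exact hTφX.trans hX2
          _ = 2 * K * N := one_mul _
      have hc : 0 ≤ 2 * (L : ℝ) ^ 2 * η := by positivity
      calc 2 * (L : ℝ) ^ 2 * η * δ₀ * Tφ = (2 * (L : ℝ) ^ 2 * η) * (δ₀ * Tφ) := by ring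
        _ ≤ (2 * (L : ℝ) ^ 2 * η) * (2 * K * N) := mul_le_mul_of_nonneg_left hδT hc
        _ = (4 * (L : ℝ) ^ 2 * η) * (K * N) := by ring
    calc ((L : ℝ) ^ j * η) ^ 2 * ‖covDerivFwd η U₀ ν (fun z => φ z τ) y‖
        ≤ ((L : ℝ) ^ j * η) ^ 2 * ‖covDerivFwd η (1 : Site d → Fin d → 𝔸ˣ) ν (fun z => φ z τ) y‖
            + ((L : ℝ) ^ j * η) ^ 2 * (η⁻¹ * (2 * δ₀ * Tφ)) := by rw [← mul_add]; exact mul_le_mul_of_nonneg_left hcurv hw2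
      _ ≤ B * N' + ((L : ℝ) * η) ^ 2 * (η⁻¹ * (2 * δ₀ * Tφ)) :=
          add_le_add hflat (mul_le_mul_of_nonneg_right (hpow2 j hj) (by positivity))
      _ = B * N' + 2 * (L : ℝ) ^ 2 * η * δ₀ * Tφ := by rw [e]
      _ ≤ 2 * B * N + (4 * (L : ℝ) ^ 2 * η) * (K * N) := add_le_add hBN' hrest
      _ = (2 * B + (4 * (L : ℝ) ^ 2 * η) * K) * N := by ring
      _ ≤ B' * N := by
          refine mul_le_mul_of_nonneg_right ?_ hN
          have h16 : 0 ≤ (16 * d * (L : ℝ) ^ 3 * η) * K := by positivity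
          have hsplit : (4 * (L : ℝ) ^ 2 * η + 16 * d * (L : ℝ) ^ 3 * η) * K =
              (4 * (L : ℝ) ^ 2 * η) * K + (16 * d * (L : ℝ) ^ 3 * η) * K := by ring
          linarith
  · -- `(Lʲη)³|Δ^η_{U₀}φ| ≤ B N′ + (Lη)³·8d·η⁻²·δ₀·Tφ`
    have hΔ := norm_covLap_sub_flat_le hU hδ hη hδ0 (g := fun z => φ z τ) (fun z => hφle z τ) y
    have hcurv : ‖covLap η U₀ (fun z => φ z τ) y‖ ≤
        ‖covLap η (1 : Site d → Fin d → 𝔸ˣ) (fun z => φ z τ) y‖ + 8 * d * (η ^ 2)⁻¹ * δ₀ * Tφ :=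
      (norm_le_insert' _ _).trans (add_le_add le_rfl hΔ)
    have hw3 : 0 ≤ ((L : ℝ) ^ j * η) ^ 3 := pow_nonneg hw0 3
    have e : ((L : ℝ) * η) ^ 3 * (8 * d * (η ^ 2)⁻¹ * δ₀ * Tφ) = 8 * d * (L : ℝ) ^ 3 * η * δ₀ * Tφ := by
      have hηne : η ≠ 0 := hη.ne'
      have hc : η ^ 3 * (η ^ 2)⁻¹ = η := by
        rw [pow_succ, mul_comm (η ^ 2) η, mul_assoc, mul_inv_cancel₀ (pow_ne_zero 2 hηne), mul_one]
      calc ((L : ℝ) * η) ^ 3 * (8 * d * (η ^ 2)⁻¹ * δ₀ * Tφ) = (L : ℝ) ^ 3 * (η ^ 3 * (η ^ 2)⁻¹) * (8 * d * δ₀ * Tφ) := by ring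
        _ = 8 * d * (L : ℝ) ^ 3 * η * δ₀ * Tφ := by rw [hc]; ring
    have hrest : 8 * d * (L : ℝ) ^ 3 * η * δ₀ * Tφ ≤ (16 * d * (L : ℝ) ^ 3 * η) * (K * N) := by
      have hδT : δ₀ * Tφ ≤ 2 * K * N := by
        calc δ₀ * Tφ ≤ 1 * (2 * K * N) := by gcongr; exact hTφX.trans hX2
          _ = 2 * K * N := one_mul _
      have hc : 0 ≤ 8 * d * (L : ℝ) ^ 3 * η := by positivity
      calc 8 * d * (L : ℝ) ^ 3 * η * δ₀ * Tφ = (8 * d * (L : ℝ) ^ 3 * η) * (δ₀ * Tφ) := by ring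
        _ ≤ (8 * d * (L : ℝ) ^ 3 * η) * (2 * K * N) := mul_le_mul_of_nonneg_left hδT hc
        _ = (16 * d * (L : ℝ) ^ 3 * η) * (K * N) := by ring
    calc ((L : ℝ) ^ j * η) ^ 3 * ‖covLap η U₀ (fun z => φ z τ) y‖
        ≤ ((L : ℝ) ^ j * η) ^ 3 * ‖covLap η (1 : Site d → Fin d → 𝔸ˣ) (fun z => φ z τ) y‖
            + ((L : ℝ) ^ j * η) ^ 3 * (8 * d * (η ^ 2)⁻¹ * δ₀ * Tφ) := by rw [← mul_add]; exact mul_le_mul_of_nonneg_left hcurv hw3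
      _ ≤ B * N' + ((L : ℝ) * η) ^ 3 * (8 * d * (η ^ 2)⁻¹ * δ₀ * Tφ) :=
          add_le_add t3 (mul_le_mul_of_nonneg_right (hpow3 j hj) (by positivity))
      _ = B * N' + 8 * d * (L : ℝ) ^ 3 * η * δ₀ * Tφ := by rw [e]
      _ ≤ 2 * B * N + (16 * d * (L : ℝ) ^ 3 * η) * (K * N) := add_le_add hBN' hrest
      _ = (2 * B + (16 * d * (L : ℝ) ^ 3 * η) * K) * N := by ring
      _ ≤ B' * N := by
          refine mul_le_mul_of_nonneg_right ?_ hN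
          have h4 : 0 ≤ (4 * (L : ℝ) ^ 2 * η) * K := by positivity
          have hsplit : (4 * (L : ℝ) ^ 2 * η + 16 * d * (L : ℝ) ^ 3 * η) * K =
              (4 * (L : ℝ) ^ 2 * η) * K + (16 * d * (L : ℝ) ^ 3 * η) * K := by ring
          linarith

end Literature.MathematicalPhysics.QuantumFieldTheory.Balaban1983to89.B8Ineq159CurvedCubeMemberPerCube

end
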